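import Summits.CriticalPhenomena.PercolationContinuityZ3.Theorems.PercNearOneGluingNoHeavyLowerTailQ44PairingChains
import HarnessLib

/-!
# The cyclic pairing rows `F_cyc`, `F_cyc′` are theorems at law level: the whole dart-free layer of R4 holds for every weighted graph

Support file for crux `stmt-CriticalPhenomena-4575` (master-family programme; Conjecture W / packing `U` line), seat `prim-l12-p6` gen 32;
memo `run/shared/lean/prim/prim-l12/FROM-prim-l12-p6-g32-R4-LAYERS.md` §2.  Cells as in `FourPointAtoms.pat4`
(`0 ⊥, 1 cy, 2 by, 3 bc, 4 ay, 5 ac, 6 ab, 8 R = ay|bc, 9 Q = ac|by, 11 P = ab|cy, 14 ⊤`); pairs of `P` = `{ab, cy}`, of `Q` = `{ac, by}`, of `R` = `{ay, bc}`.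

`…Q44PairingChains` proved the six transitive dart-free vertex rows of the R4 polytope ("pairing chains") by nine-type label certificates.
The two remaining dart-free vertices are the cyclic orientations
  `F_cyc  = e₂(c₈,c₉,c₁₁) + c₁₁(c₅+c₂) + c₉(c₄+c₃) + c₈(c₆+c₁)`   (P charges Q's pairs, Q charges R's, R charges P's),
  `F_cyc′ = e₂(c₈,c₉,c₁₁) + c₁₁(c₄+c₃) + c₈(c₅+c₂) + c₉(c₆+c₁)`   (the mirror orientation),
which admit NO label certificate (exhaustive search, memo §2) and are not in the cone of the chains.  At LAW level they nevertheless follow from the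
three cyclic rotations of a chain by a weighted average whose weights are the pairing probabilities themselves:
with `x_π = c_π`, `y_π = Σ (pairs of π)`, the differences `F_cyc − chain` are `x_R y_P − x_P y_R`, `x_P y_Q − x_Q y_P`, `x_Q y_R − x_R y_Q`, and
`x_Q·(x_R y_P − x_P y_R) + x_R·(x_P y_Q − x_Q y_P) + x_P·(x_Q y_R − x_R y_Q) = 0` identically; hence `(x_P+x_Q+x_R)·F_cyc ≤ (x_P+x_Q+x_R)·c₀c₁₄`.

* `TwoCopyMono.cyclic_of_three_chains` — the abstract real-inequality lemma (weighted cyclic average);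
* **`TwoCopyMono.fCyc_pack`**, **`TwoCopyMono.fCycMirror_pack`** — `F_cyc ≤ c₀c₁₄`, `F_cyc′ ≤ c₀c₁₄` on every finite weighted graph, all `n`.
With `…Q44PairingChains` this makes EVERY dart-free B_4-valid complementary-type row a theorem at law level (the fibre/lattice form of `F_cyc` stays open:
the rotation argument uses the product structure `c_π·c_s` of the law).  No sorries, no named facts, no new definitions; standard axioms.
-/

namespace Summit.CriticalPhenomena.PercolationContinuityZ3.Theorems

namespace TwoCopyMono

open Finset FourPointAtoms

/-- **Weighted cyclic average of three chains.**  If `e + x_P(y_Q+y_R) + x_Q y_R ≤ g`, `e + x_Q(y_R+y_P) + x_R y_P ≤ g` and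
`e + x_R(y_P+y_Q) + x_P y_Q ≤ g` with `x_P, x_Q, x_R ≥ 0`, then `e + x_P y_Q + x_Q y_R + x_R y_P ≤ g`: multiply the three hypotheses by
`x_Q, x_R, x_P` and add — the antisymmetric differences cancel. [this work] -/
theorem cyclic_of_three_chains {g e xP xQ xR yP yQ yR : ℝ} (hxP : 0 ≤ xP) (hxQ : 0 ≤ xQ) (hxR : 0 ≤ xR)
    (h1 : e + xP * (yQ + yR) + xQ * yR ≤ g) (h2 : e + xQ * (yR + yP) + xR * yP ≤ g)
    (h3 : e + xR * (yP + yQ) + xP * yQ ≤ g) :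
    e + xP * yQ + xQ * yR + xR * yP ≤ g := by
  have k1 := mul_le_mul_of_nonneg_left h1 hxQ
  have k2 := mul_le_mul_of_nonneg_left h2 hxR
  have k3 := mul_le_mul_of_nonneg_left h3 hxP
  have key : (xP + xQ + xR) * (e + xP * yQ + xQ * yR + xR * yP) ≤ (xP + xQ + xR) * g := by nlinarith [k1, k2, k3]
  by_cases hS : xP + xQ + xR = 0
  · have hP : xP = 0 := by linarith
    have hQ : xQ = 0 := by linarith
    have hR : xR = 0 := by linarith
    subst hP; subst hQ; subst hR
    linarith
  · have hS' : 0 < xP + xQ + xR := lt_of_le_of_ne (by linarith) (Ne.symm hS)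
    exact le_of_mul_le_mul_left key hS'

variable {n : ℕ}

/-- **The cyclic pairing row `F_cyc` (all `n`, law level):** `c₈c₉ + c₈c₁₁ + c₉c₁₁ + c₁₁(c₅+c₂) + c₉(c₄+c₃) + c₈(c₆+c₁) ≤ c₀·c₁₄`, i.e.
`e₂(P(ab|cy),P(ac|by),P(ay|bc)) + P(ab|cy)[P(ac|b|y)+P(a|by|c)] + P(ac|by)[P(ay|b|c)+P(a|bc|y)] + P(ay|bc)[P(ab|c|y)+P(a|b|cy)] ≤ P(abcy)·P(a|b|c|y)`
on every finite weighted graph — from the chains `P>Q>R`, `Q>R>P`, `R>P>Q` by `cyclic_of_three_chains`. [this work] -/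
theorem fCyc_pack (w : Sym2 (Fin n) → unitInterval) (a b c y : Fin n) :
    cell w a b c y 8 * cell w a b c y 9 + cell w a b c y 8 * cell w a b c y 11 + cell w a b c y 9 * cell w a b c y 11 +
      cell w a b c y 11 * (cell w a b c y 5 + cell w a b c y 2) + cell w a b c y 9 * (cell w a b c y 4 + cell w a b c y 3) +
      cell w a b c y 8 * (cell w a b c y 6 + cell w a b c y 1) ≤ cell w a b c y 14 * cell w a b c y 0 := by
  have h1 := chain_PQR_pack w a b c y
  have h2 := chain_QRP_pack w a b c y
  have h3 := chain_RPQ_pack w a b c y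
  have key := cyclic_of_three_chains (g := cell w a b c y 14 * cell w a b c y 0)
    (e := cell w a b c y 8 * cell w a b c y 9 + cell w a b c y 8 * cell w a b c y 11 + cell w a b c y 9 * cell w a b c y 11)
    (xP := cell w a b c y 11) (xQ := cell w a b c y 9) (xR := cell w a b c y 8)
    (yP := cell w a b c y 6 + cell w a b c y 1) (yQ := cell w a b c y 5 + cell w a b c y 2) (yR := cell w a b c y 4 + cell w a b c y 3)
    (cell_nonneg w a b c y 11) (cell_nonneg w a b c y 9) (cell_nonneg w a b c y 8) (by convert h1 using 1; ring) (by convert h2 using 1; ring) (by convert h3 using 1; ring)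
  linarith

/-- **The mirror cyclic row `F_cyc′` (all `n`, law level):** `c₈c₉ + c₈c₁₁ + c₉c₁₁ + c₁₁(c₄+c₃) + c₈(c₅+c₂) + c₉(c₆+c₁) ≤ c₀·c₁₄`
(P charges R's pairs, R charges Q's, Q charges P's) — from the chains `P>R>Q`, `R>Q>P`, `Q>P>R`. [this work] -/
theorem fCycMirror_pack (w : Sym2 (Fin n) → unitInterval) (a b c y : Fin n) :
    cell w a b c y 8 * cell w a b c y 9 + cell w a b c y 8 * cell w a b c y 11 + cell w a b c y 9 * cell w a b c y 11 +
      cell w a b c y 11 * (cell w a b c y 4 + cell w a b c y 3) + cell w a b c y 8 * (cell w a b c y 5 + cell w a b c y 2) +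
      cell w a b c y 9 * (cell w a b c y 6 + cell w a b c y 1) ≤ cell w a b c y 14 * cell w a b c y 0 := by
  have h1 := chain_PRQ_pack w a b c y
  have h2 := chain_RQP_pack w a b c y
  have h3 := chain_QPR_pack w a b c y
  have key := cyclic_of_three_chains (g := cell w a b c y 14 * cell w a b c y 0)
    (e := cell w a b c y 8 * cell w a b c y 9 + cell w a b c y 8 * cell w a b c y 11 + cell w a b c y 9 * cell w a b c y 11)
    (xP := cell w a b c y 11) (xQ := cell w a b c y 8) (xR := cell w a b c y 9)
    (yP := cell w a b c y 6 + cell w a b c y 1) (yQ := cell w a b c y 4 + cell w a b c y 3) (yR := cell w a b c y 5 + cell w a b c y 2)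
    (cell_nonneg w a b c y 11) (cell_nonneg w a b c y 8) (cell_nonneg w a b c y 9) (by convert h1 using 1; ring) (by convert h2 using 1; ring) (by convert h3 using 1; ring)
  linarith

end TwoCopyMono

end Summit.CriticalPhenomena.PercolationContinuityZ3.Theorems
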